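import Summits.AtomisticToContinuum.HydrodynamicLimit.Theses.OneFlightGossipEngine
import HarnessLib

/-!
# Sketch — crux `ClampedTransferDock` (stmt-AtomisticToContinuum-16665), round 1, ideator 2

First lemmas of the two crux idea cards of this seat (they need not be proved; they must elaborate):

* card `lone-carriers-tau-priced` (child (ii) of the dock, the cubic coherence input S6′):
  `ell`, `Comov`, `InExtCluster`, `Collective` (the lone / collective split of suprathermal carriers),
  `LinearLedgerAprioriBound` (the LINEAR a-priori entropy bound, first provable lemma of the line),
  `ExtendedClusterTightness` (= [B], the irreducible true-law residual, instantaneous),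
  `LoneCoherenceLD` (= [A], the reference-law large-deviation input, every tilt, τ in the exponent),
  `sum_le_two_mul_sum_filter` (the cap-tail domination, discrete form, PROVED) and `CapTailWindow`
  (its window form, stated).
* card `covariant-transfer-clamp` (children (iii)/(iv)): `CovTransferAt`, `ClampedTransferWindowLDCov`
  (C′ with the Galilean-covariant, dimensionally homogeneous transfer clamp) and the reduction target
  `ConstantsAreFree`.
-/

noncomputable section

namespace Summit.AtomisticToContinuum.HydrodynamicLimit.Cruxes.ClampedTransferDock.IdeatorTwo

open scoped BigOperators ENNReal Classical
open MeasureTheory Set InformationTheory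
open Literature.MathematicalPhysics.KineticTheory Literature.Analysis.FluidPDE Literature.Analysis.FunctionSpaces
open Summit.AtomisticToContinuum.HydrodynamicLimit.Theses.OneFlightGossipEngine

/-! ## Card 1 — `lone-carriers-tau-priced` -/

/-- The route's mean free path `ℓ_N = (N+1)^{-1/3} / (√2 π σ²)` (`ℓ_N / ε_N = 1/(√2 π σ³)`). -/
def ell (σ : ℝ) (N : ℕ) : ℝ :=
  ((N : ℝ) + 1) ^ (-(1 / 3 : ℝ)) / (Real.sqrt 2 * Real.pi * σ ^ 2)

variable {N : ℕ}

/-- The COMOVING-FAST relation at suprathermal level `K` (peculiar speeds w.r.t. the Euler velocity `u`):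
both particles faster than `K`, within `ϱ ℓ` in space (minimal-image distance) and within `ϑ K` in velocity. -/
def Comov (ℓ ϱ ϑ K : ℝ) (u : T3 → V3) (z : Config (N + 1) (Fin 3) T3) (i j : Fin (N + 1)) : Prop :=
  K < ‖(z i).2 - u (z i).1‖ ∧ K < ‖(z j).2 - u (z j).1‖ ∧
    Torus.euclidDist (z i).1 (z j).1 ≤ ϱ * ℓ ∧ ‖(z i).2 - (z j).2‖ ≤ ϑ * K

/-- `i` belongs to an EXTENDED comoving-fast cluster: its connected component for `Comov` contains two
particles at minimal-image distance `≥ D ℓ` (diameter at least `D` mean free paths). -/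
def InExtCluster (ℓ ϱ ϑ K D : ℝ) (u : T3 → V3) (z : Config (N + 1) (Fin 3) T3) (i : Fin (N + 1)) : Prop :=
  ∃ j k : Fin (N + 1), Relation.ReflTransGen (Comov ℓ ϱ ϑ K u z) i j ∧
    Relation.ReflTransGen (Comov ℓ ϱ ϑ K u z) i k ∧ D * ℓ ≤ Torus.euclidDist (z j).1 (z k).1

/-- `i` is COLLECTIVE: fast, velocity-matched (`ϑ K`) to a member `j` of an extended cluster, and within the
shelter range of that cluster — `κ` times a realised chord `dist(x_k, x_l)` of `j`'s component, stretched by the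
Mach factor `1 + ‖W_i‖/√θm` (wake length of a supersonic body). Members are collective (`k = l = j`, chord `0`,
distance `0`). LONE := fast and not collective. -/
def Collective (ℓ ϱ ϑ K D κ θm : ℝ) (u : T3 → V3) (z : Config (N + 1) (Fin 3) T3) (i : Fin (N + 1)) : Prop :=
  K < ‖(z i).2 - u (z i).1‖ ∧
    ∃ j k l : Fin (N + 1), InExtCluster ℓ ϱ ϑ K D u z j ∧
      Relation.ReflTransGen (Comov ℓ ϱ ϑ K u z) j k ∧ Relation.ReflTransGen (Comov ℓ ϱ ϑ K u z) j l ∧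
      ‖(z i).2 - (z j).2‖ ≤ ϑ * K ∧
      Torus.euclidDist (z i).1 (z j).1 ≤
        κ * Torus.euclidDist (z k).1 (z l).1 * (1 + ‖(z i).2 - u (z i).1‖ / Real.sqrt θm)

/-- **First provable lemma of the line — the LINEAR a-priori entropy bound along the reference family.**
`LedgerAprioriBound` (S7a of line IdeatorTwoSketch, landed tools `klDiv_lawAt_localGibbsLaw_le_of_bounds`,
`toReal_klDiv_lawAt_localGibbsLaw_eq`) with the constant made explicit and UNIFORM IN `N`:
`KL(lawAt Φ λ_N s ‖ ψ_s) ≤ C (N+1)` for all `s ∈ [0,t]`, all `N`, all flows. (The landed bound is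
`(N+1)(I₀ + C(1+K₀)) + |log Z₁| + (N+1) log A − log Z₀` with `I₀, K₀` per-particle pairings of the initial local
Gibbs law and `log Z`'s of order `N+1`; what is left is their `N`-uniform control.) It is what lets the entropy
inequality run at tilt `γ = C/ε` OUTSIDE the Gronwall loop. -/
def LinearLedgerAprioriBound : Prop :=
  ∀ (r : ℝ) (Rf : ℝ → ℝ), 0 < r → (∀ x ∈ Icc 0 r, 1 ≤ Rf x ∧ Rf x ≤ 2) → ContinuousOn Rf (Icc 0 r) →
    ∀ (a₀ θ₀ : T3 → ℝ) (u₀ : T3 → V3), Continuous a₀ → Continuous θ₀ → Continuous u₀ →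
      (∀ x, 0 < a₀ x) → (∀ x, 0 < θ₀ x) →
      ∀ σ : ℝ, 0 < σ → σ < 1 / 2 →
        ∀ (T : ℝ) (ρ θ : ℝ → T3 → ℝ) (u : ℝ → T3 → V3), IsHardSphereEulerSolution σ T ρ u θ →
          ∀ t ∈ Set.Ioo 0 T, (∀ s ∈ Set.Icc 0 t, ∀ x, ρ s x * σ ^ 3 < r) →
            ∃ C : ℝ, ∀ (N : ℕ) (Φ : HardSphereFlow (Torus.geometry (Fin 3)) (hsDiameter σ N) (N + 1)),
              ∀ s ∈ Set.Icc 0 t,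
                klDiv (Φ.lawAt (localGibbsLaw σ a₀ u₀ θ₀ N Φ) s)
                  (localGibbsLaw σ (fun x => ρ s x * Rf (σ ^ 3 * ρ s x)) (u s) (θ s) N Φ) ≤
                  ENNReal.ofReal (C * ((N : ℝ) + 1))

/-- **[B] `ExtendedClusterTightness` — the irreducible TRUE-LAW residual of the coherence input (INSTANTANEOUS).**
Frame of `EnergyCurrentTails` (stmt-9235). Under the true pre-shock law, at every time `r ≤ t`, the cubic content of
COLLECTIVE suprathermal carriers — fast particles that are members of, or velocity-matched to and sheltered by, a
comoving-fast cluster of diameter `≥ D₀ ℓ_N` — vanishes as `D₀ → ∞`, uniformly in `N`, for every suprathermal level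
`K⋆` above a threshold `K₀(ϱ, ϑ, κ, σ, profiles)` (below which the comoving-fast graph percolates already under the
local Gibbs reference: kit job j020200). No window, no dynamics in the statement: a property of the `D₀/ϱ`-body
correlations of the fast tail at one time. -/
def ExtendedClusterTightness : Prop :=
  ∀ (a₀ θ₀ : T3 → ℝ) (u₀ : T3 → V3), Continuous a₀ → Continuous θ₀ → Continuous u₀ →
    (∀ x, 0 < a₀ x) → (∀ x, 0 < θ₀ x) →
    ∃ σ₀ : ℝ, 0 < σ₀ ∧ ∀ σ : ℝ, 0 < σ → σ < σ₀ →
    ∀ (T : ℝ) (ρ θ : ℝ → T3 → ℝ) (u : ℝ → T3 → V3), IsHardSphereEulerSolution σ T ρ u θ →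
    ∀ Φ : (N : ℕ) → HardSphereFlow (Torus.geometry (Fin 3)) (hsDiameter σ N) (N + 1),
    TendstoHydroFieldsAt (fun N => localGibbsLaw σ a₀ u₀ θ₀ N (Φ N)) Φ ρ u θ 0 →
    ∀ t ∈ Set.Ico 0 T, ∀ ϱ : ℝ, 1 ≤ ϱ → ∀ ϑ : ℝ, 0 < ϑ → ϑ < 1 → ∀ κ : ℝ, 1 ≤ κ →
    ∃ K₀ : ℝ, 0 < K₀ ∧ ∀ Kstar : ℝ, K₀ ≤ Kstar → ∀ ε : ℝ, 0 < ε →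
    ∃ D₀ : ℝ, 0 < D₀ ∧ ∃ N₀ : ℕ, ∀ N : ℕ, N₀ ≤ N → ∀ r ∈ Set.Icc 0 t,
      (let P := localGibbsLaw σ a₀ u₀ θ₀ N (Φ N)
       ∫⁻ z, ENNReal.ofReal (((N : ℝ) + 1)⁻¹ * ∑ i : Fin (N + 1),
           (if Collective (ell σ N) ϱ ϑ Kstar D₀ κ (θ r ((Φ N).flow r z i).1) (u r) ((Φ N).flow r z) i
            then ‖((Φ N).flow r z i).2 - u r ((Φ N).flow r z i).1‖ ^ 3 else 0)) ∂P ≤ ENNReal.ofReal ε)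

/-- **[A] `LoneCoherenceLD` — the REFERENCE-LAW large-deviation input, ALONG FAMILIES, EVERY tilt, `τ` in the
exponent.** Frame of `KineticCurrentsWindowLDFamily` (stmt-16659: jointly continuous families of profiles, the
packing guard, all flow families, `s ∈ [0,t₁]` innermost). For the local Gibbs datum `ψ_s` and the window `[0,w]`,
`w = τ(N+1)^{-1/3}`: with `W_i(r) = v_i(r) − u_s(x_i(r))`, the LONE suprathermal cubic content
`c_i^lone = w⁻¹∫₀ʷ ‖W_i‖³ 1{K⋆ < ‖W_i‖} 1{¬ Collective at time r}` capped at `L`, summed over the `(η, R)`-COHERENT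
particles (`‖w⁻¹∫ R(s, x_i, ‖W_i‖²) W_i‖ > η w⁻¹∫‖W_i‖³`, the test of S6′), has log-mgf `≤ δ(N+1)` at tilt `γ`
for EVERY `γ, δ > 0` once `τ ≥ τ₀(… , γ, δ, L)`: every mechanism that keeps a LONE carrier coherent (void corridor,
lucky forward scattering, a single Gaussian fast episode, erosion debris of a cluster, a small cluster) has reference
cost growing linearly in `τ`, and the cap `L` bounds the gain per particle. -/
def LoneCoherenceLD : Prop :=
  ∃ η₀ : ℝ, 0 < η₀ ∧ ∀ (t₁ : ℝ) (a θ₀ : ℝ → T3 → ℝ) (u₀ : ℝ → T3 → V3),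
    Continuous (Function.uncurry a) → Continuous (Function.uncurry θ₀) → Continuous (Function.uncurry u₀) →
    (∀ s x, 0 < a s x) → (∀ s x, 0 < θ₀ s x) →
    ∀ σ : ℝ, 0 < σ → (∀ s ∈ Set.Icc 0 t₁, σ ^ 3 * (⨆ x, a s x) ≤ η₀ * ∫ x, a s x) →
    ∀ Φ : (N : ℕ) → HardSphereFlow (Torus.geometry (Fin 3)) (hsDiameter σ N) (N + 1),
    ∀ Kstar : ℝ, 0 < Kstar →
    ∀ R : ℝ → T3 → ℝ → ℝ, Measurable (fun p : ℝ × T3 × ℝ => R p.1 p.2.1 p.2.2) →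
    (∀ s x s', s' ≤ Kstar ^ 2 → R s x s' = 0) → (∀ s x s', |R s x s'| ≤ |s'|) →
    ∀ η : ℝ, 0 < η → ∀ ϱ : ℝ, 1 ≤ ϱ → ∀ ϑ : ℝ, 0 < ϑ → ϑ < 1 → ∀ κ : ℝ, 1 ≤ κ → ∀ D₀ : ℝ, 0 < D₀ →
    ∀ L : ℝ, 0 < L → ∀ γ : ℝ, 0 < γ → ∀ δ : ℝ, 0 < δ →
    ∃ τ₀ : ℝ, 0 < τ₀ ∧ ∀ τ : ℝ, τ₀ ≤ τ → ∃ N₀ : ℕ, ∀ N : ℕ, N₀ ≤ N → ∀ s ∈ Set.Icc 0 t₁,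
      (let w : ℝ := τ * ((N : ℝ) + 1) ^ (-(1 / 3 : ℝ))
       let P := localGibbsLaw σ (a s) (u₀ s) (θ₀ s) N (Φ N)
       let W := fun (i : Fin (N + 1)) (r : ℝ) (z : Config (N + 1) (Fin 3) T3) =>
         ((Φ N).flow r z i).2 - u₀ s ((Φ N).flow r z i).1
       let cub := fun (i : Fin (N + 1)) (z : Config (N + 1) (Fin 3) T3) =>
         w⁻¹ * ∫ r in (0 : ℝ)..w, ‖W i r z‖ ^ 3
       let cubLone := fun (i : Fin (N + 1)) (z : Config (N + 1) (Fin 3) T3) =>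
         w⁻¹ * ∫ r in (0 : ℝ)..w,
           (if Kstar < ‖W i r z‖ ∧
               ¬ Collective (ell σ N) ϱ ϑ Kstar D₀ κ (θ₀ s ((Φ N).flow r z i).1) (u₀ s) ((Φ N).flow r z) i
            then ‖W i r z‖ ^ 3 else 0)
       let qbar := fun (i : Fin (N + 1)) (z : Config (N + 1) (Fin 3) T3) =>
         w⁻¹ • ∫ r in (0 : ℝ)..w, (R s ((Φ N).flow r z i).1 (‖W i r z‖ ^ 2)) • W i r z
       ∫⁻ z, ENNReal.ofReal (Real.exp (γ * ∑ i : Fin (N + 1),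
           (if η * cub i z < ‖qbar i z‖ then min (cubLone i z) L else 0))) ∂P ≤
         ENNReal.ofReal (Real.exp (δ * ((N : ℝ) + 1))))

/-- **Cap-tail domination, discrete form (PROVED).** If the average of non-negative reals over a finite set exceeds
`L ≥ 0`, the whole sum is at most twice the sum of the terms above `L/2`. (The terms below `L/2` total at most
`(L/2)·card < (sum)/2`.) Window form: `CapTailWindow` below; used with `f = ‖W_i‖³ 1{fast}` and ECT at each time of
the window to pay `Σ_i c_i 1{c_i > L} ≤ 2 Σ_i w⁻¹∫ ‖W_i‖³ 1{‖W_i‖³ > L/2}` RATE-FREE (the cap sits outside every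
exponential — this is how the card honours negatives 14607). -/
theorem sum_le_two_mul_sum_filter {ι : Type*} (s : Finset ι) (f : ι → ℝ) (hf : ∀ i ∈ s, 0 ≤ f i)
    {L : ℝ} (hL : 0 ≤ L) (h : L * s.card < ∑ i ∈ s, f i) :
    ∑ i ∈ s, f i ≤ 2 * ∑ i ∈ s.filter (fun i => L / 2 < f i), f i := by
  classical
  have hsplit : ∑ i ∈ s, f i =
      (∑ i ∈ s.filter (fun i => L / 2 < f i), f i) +
        ∑ i ∈ s.filter (fun i => ¬ (L / 2 < f i)), f i :=
    (Finset.sum_filter_add_sum_filter_not s (fun i => L / 2 < f i) f).symm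
  have hsmall : ∑ i ∈ s.filter (fun i => ¬ (L / 2 < f i)), f i ≤ L / 2 * s.card := by
    calc ∑ i ∈ s.filter (fun i => ¬ (L / 2 < f i)), f i
        ≤ ∑ i ∈ s.filter (fun i => ¬ (L / 2 < f i)), L / 2 := by
          apply Finset.sum_le_sum
          intro i hi
          simp only [Finset.mem_filter, not_lt] at hi
          exact hi.2
      _ = L / 2 * ((s.filter (fun i => ¬ (L / 2 < f i))).card : ℝ) := by
          rw [Finset.sum_const, nsmul_eq_mul, mul_comm]
      _ ≤ L / 2 * (s.card : ℝ) := by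
          have hc : ((s.filter (fun i => ¬ (L / 2 < f i))).card : ℝ) ≤ (s.card : ℝ) := by
            exact_mod_cast Finset.card_filter_le s _
          have hL2 : 0 ≤ L / 2 := by linarith
          exact mul_le_mul_of_nonneg_left hc hL2
  have hbig_nonneg : 0 ≤ ∑ i ∈ s.filter (fun i => L / 2 < f i), f i :=
    Finset.sum_nonneg (fun i hi => hf i (Finset.mem_filter.1 hi).1)
  nlinarith [hsplit, hsmall, h, hbig_nonneg]

/-- **Cap-tail domination, window form (statement).** For an integrable `f ≥ 0` on `[0,w]`, `w > 0`, `0 ≤ L`: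
`L < w⁻¹∫₀ʷ f` implies `w⁻¹∫₀ʷ f ≤ 2 w⁻¹ ∫₀ʷ f·1{L/2 < f}`. [folklore] -/
def CapTailWindow : Prop :=
  ∀ (w L : ℝ) (f : ℝ → ℝ), 0 < w → 0 ≤ L → IntervalIntegrable f volume 0 w → (∀ r ∈ Set.Icc 0 w, 0 ≤ f r) →
    L < w⁻¹ * ∫ r in (0 : ℝ)..w, f r →
      w⁻¹ * ∫ r in (0 : ℝ)..w, f r ≤ 2 * (w⁻¹ * ∫ r in (0 : ℝ)..w, (if L / 2 < f r then f r else 0))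

/-! ## Card 2 — `covariant-transfer-clamp` -/

/-- C′ at FIXED constants `(σ; a₀, θ₀, u₀)` with the COVARIANT TRANSFER CLAMP: transfer activity
`act_i = (σ/τ) Σ_{c : c.fst = i} (‖Δv‖ + |‖v⁺ − u₀‖² − ‖v⁻ − u₀‖²| / (2√θ₀))` — the energy impulse is taken in the
rest frame `u₀` (Galilean covariance) and divided by the thermal speed `√θ₀` (dimensional homogeneity: both summands
scale like a velocity). Everything else — rows, EOS projections, centring, bound — is VERBATIM the typed
`ClampedTransferWindowLD` (TwoClocks crux stmt-16623 / line IdeatorTwoSketch §1), whose energy impulse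
`|‖v⁺‖² − ‖v⁻‖²|/2` (lab frame, un-normalised) is neither boost-invariant nor homogeneous. -/
def CovTransferAt (σ a₀ θ₀ : ℝ) (u₀ : V3) : Prop :=
  ∀ Φ : (N : ℕ) → HardSphereFlow (Torus.geometry (Fin 3)) (hsDiameter σ N) (N + 1),
  ∀ φ : T3 → ℝ, Torus.IsSmooth φ →
  ∃ V₀ : ℝ, 0 < V₀ ∧ ∀ V : ℝ, V₀ ≤ V → ∃ β₀ : ℝ, 0 < β₀ ∧ ∀ β : ℝ, |β| ≤ β₀ → ∀ ε : ℝ, 0 < ε →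
  ∃ τ₀ : ℝ, 0 < τ₀ ∧ ∀ τ : ℝ, τ₀ ≤ τ → ∃ N₀ : ℕ, ∀ N : ℕ, N₀ ≤ N →
    (let w : ℝ := τ * ((N : ℝ) + 1) ^ (-(1 / 3 : ℝ))
     let P := localGibbsLaw σ (fun _ => a₀) (fun _ => u₀) (fun _ => θ₀) N (Φ N)
     let Z : ℝ := hsCompressibility (σ ^ 3)
     let Z' : ℝ := deriv hsCompressibility (σ ^ 3)
     let act := fun (i : Fin (N + 1)) (z : Config (N + 1) (Fin 3) T3) =>
       σ / τ * (Φ N).collisionSum (Set.Ioc 0 w) (fun c => if c.fst = i then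
         ‖c.postVel.1 - c.preVel.1‖ +
           |‖c.postVel.1 - u₀‖ ^ 2 - ‖c.preVel.1 - u₀‖ ^ 2| / (2 * Real.sqrt θ₀) else 0) z
     let ω := fun (i : Fin (N + 1)) (z : Config (N + 1) (Fin 3) T3) => if act i z ≤ V then (1 : ℝ) else 0
     let Xm := fun (k : Fin 3) (z : Config (N + 1) (Fin 3) T3) =>
       (Φ N).collisionSum (Set.Ioc 0 w)
         (fun c => ω c.fst z * ω c.snd z * ((φ c.fstPos - φ c.sndPos) * (c.postVel.1 k - c.preVel.1 k)) / 2) z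
     let Am := fun (k : Fin 3) (z : Config (N + 1) (Fin 3) T3) =>
       ∫ r in (0 : ℝ)..w, ∑ i, Torus.partialDeriv k φ ((Φ N).flow r z i).1 *
         (θ₀ * σ ^ 3 * Z' + (1 / 3) * (Z - 1) * ‖((Φ N).flow r z i).2 - u₀‖ ^ 2)
     let Xe := fun (z : Config (N + 1) (Fin 3) T3) =>
       (Φ N).collisionSum (Set.Ioc 0 w)
         (fun c => ω c.fst z * ω c.snd z *
           ((φ c.fstPos - φ c.sndPos) * ((‖c.postVel.1‖ ^ 2 - ‖c.preVel.1‖ ^ 2) / 2)) / 2) z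
     let Ae := fun (z : Config (N + 1) (Fin 3) T3) =>
       ∫ r in (0 : ℝ)..w, ∑ i,
         ((∑ l, u₀ l * Torus.partialDeriv l φ ((Φ N).flow r z i).1) *
             (θ₀ * σ ^ 3 * Z' + (1 / 3) * (Z - 1) * ‖((Φ N).flow r z i).2 - u₀‖ ^ 2) +
           θ₀ * (Z - 1) * (∑ l, Torus.partialDeriv l φ ((Φ N).flow r z i).1 * (((Φ N).flow r z i).2 - u₀) l))
     (∀ k : Fin 3, ∫⁻ z, ENNReal.ofReal (Real.exp (β * (w⁻¹ * Xm k z - w⁻¹ * Am k z))) ∂P ≤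
         ENNReal.ofReal (Real.exp (ε * ((N : ℝ) + 1)))) ∧
       ∫⁻ z, ENNReal.ofReal (Real.exp (β * (w⁻¹ * Xe z - w⁻¹ * Ae z))) ∂P ≤
         ENNReal.ofReal (Real.exp (ε * ((N : ℝ) + 1))))

/-- **C′ with the covariant transfer clamp** (same quantifier string as the typed `ClampedTransferWindowLD`). -/
def ClampedTransferWindowLDCov : Prop :=
  ∃ σ₀ : ℝ, 0 < σ₀ ∧ ∀ (a₀ θ₀ : ℝ) (u₀ : V3), 0 < a₀ → 0 < θ₀ → ∀ σ : ℝ, 0 < σ → σ < σ₀ →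
    CovTransferAt σ a₀ θ₀ u₀

/-- **Reduction target of card 2 — CONSTANTS ARE FREE.** With the covariant clamp, the constant-profile rung at ONE
point of the `(a₀, θ₀, u₀)`-family (`a₀ = 1` — a dummy of the canonical law —, `θ₀ = 1`, `u₀ = 0`) implies it at
every point, by velocity/time scaling `(x, v, t) ↦ (x, λv, t/λ)` (`θ₀ ↦ λ²θ₀`, `τ ↦ τ/λ`, `V ↦ λ²V`,
`β ↦ β/λ³ ∧ β/λ²`) and Galilean boost `v ↦ v + U` on `𝕋³` (test function drift `O(|U| w ‖∇φ‖) → 0`); the thresholds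
transform by EXPLICIT maps, so uniformity over compact families of constants is exact — no net over black-box
thresholds (finding UNIFORMITY-9133-c2). The only family parameter a localisation of (iii) must still carry is the
reduced density `σ` (local packing), cf. KCWU card `sigma-uniform-equilibrium-transfer`. -/
def ConstantsAreFree : Prop :=
  (∃ σ₀ : ℝ, 0 < σ₀ ∧ ∀ σ : ℝ, 0 < σ → σ < σ₀ → CovTransferAt σ 1 1 0) → ClampedTransferWindowLDCov

end Summit.AtomisticToContinuum.HydrodynamicLimit.Cruxes.ClampedTransferDock.IdeatorTwo
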